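import Summits.Ventures.CertifiedQuantumChemistry.Certificates.HubbardRingL6SingletLiftBlockDuu
import Summits.Ventures.CertifiedQuantumChemistry.Certificates.HubbardRingL6SingletLiftBlockQuu
import Summits.Ventures.CertifiedQuantumChemistry.Certificates.HubbardRingL6SingletLiftBlockDmixed
import Summits.Ventures.CertifiedQuantumChemistry.Certificates.HubbardRingL6SingletLiftBlockQmixed
import Summits.Ventures.CertifiedQuantumChemistry.Certificates.HubbardRingL6SingletLiftBlockDdd
import Summits.Ventures.CertifiedQuantumChemistry.Certificates.HubbardRingL6SingletLiftBlockQdd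
import Summits.Ventures.CertifiedQuantumChemistry.Certificates.HubbardRingL6LiftPairPSD
import HarnessLib

/-!
# Ventures/CertifiedQuantumChemistry — Certificates/HubbardRingL6SingletLiftPairPSD.lean: LAYER 1 (pair blocks) of the L = 6 DQG+S²
# (singlet) lift assembly — the two-matrix `Γˢ(ε)` and the `Q`-matrix `Qˢ(ε)` of the exact singlet lift family, on the 144
# ordered-pair codes, DEFINED as signed scatter-sums of the landed singlet pair-block tables, are positive semidefinite for `0 < ε ≤ 2⁻⁵¹`

HONEST FRAMING (verbatim): certified bounds for a stated model Hamiltonian in a stated basis; not a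
claim about the real molecule beyond that model. Auxiliary objects (a polynomial family of relaxation variables of the half-filled Hubbard
6-ring's singlet-restricted level-DQG programme); no model energy is bounded here.

Seat rdm-B (gen 43; the DQG+S² twin of gen 42's `…L6LiftPairPSD.lean`, whose index tables `l6LabP/l6PosP/l6SgnP`, block sizes `l6szP`
and scatter lemmas are REUSED verbatim — the compression of the pair blocks depends on `L` only). Source: `ab-files/v44/lift2_L6_DQG_s2v0.json`
(rdm-B gen 24; words + exact-certificate grade `liminf_U ĉ_DQG+S²(6;U) ≥ 1.0357214185`); blocks
`Certificates/HubbardRingL6SingletLiftBlock{Duu,Dmixed,Ddd,Quu,Qmixed,Qdd}.lean`. THE THEOREMS: **`l6srealGG_posSemidef`**,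
**`l6srealQQ_posSemidef`** — `Γˢ(ε), Qˢ(ε) ⪰ 0` (real `144 × 144`) for `0 < ε ≤ 2⁻⁵¹`. 0 sorry; standard axioms.
-/

set_option linter.style.longLine false

namespace Summit.Ventures.CertifiedQuantumChemistry

namespace LiftL6

open Matrix Finset PencilRat BlockScatter

/-! ## §1 The coefficient matrices `Γˢ_j`, `Qˢ_j` as scatter-sums, and the real families -/

/-- The singlet lift's `Γ` pair-block coefficient tables by block number. -/
noncomputable def l6sblkD : (b : ℕ) → Fin 3 → Fin (l6szP b) → Fin (l6szP b) → ℚ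
  | 0 => l6sDuuX
  | 1 => l6sDmixedX
  | 2 => l6sDddX
  | _ + 3 => fun _ _ _ => 0

/-- The singlet lift's `Q` pair-block coefficient tables by block number. -/
noncomputable def l6sblkQ : (b : ℕ) → Fin 3 → Fin (l6szP b) → Fin (l6szP b) → ℚ
  | 0 => l6sQuuX
  | 1 => l6sQmixedX
  | 2 => l6sQddX
  | _ + 3 => fun _ _ _ => 0

/-- **`Γˢ_j`** (rational, on the 144 ordered-pair codes): the signed scatter-sum of the singlet lift's `Γ` pair blocks' `j`-th coefficient. -/
noncomputable def l6sGG (j : Fin 3) : Matrix (Fin 144) (Fin 144) ℚ :=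
  ∑ b ∈ Finset.range 3, scatterS (l6szP b) l6LabP l6PosP l6SgnP b (Matrix.of fun a c => l6sblkD b j a c)

/-- **`Qˢ_j`** (rational): the signed scatter-sum of the singlet lift's `Q` pair blocks' `j`-th coefficient. -/
noncomputable def l6sQQ (j : Fin 3) : Matrix (Fin 144) (Fin 144) ℚ :=
  ∑ b ∈ Finset.range 3, scatterS (l6szP b) l6LabP l6PosP l6SgnP b (Matrix.of fun a c => l6sblkQ b j a c)

/-- The real two-matrix family `Γˢ(ε) = Σ_j ε^j Γˢ_j`. -/
noncomputable def l6srealGG (ε : ℝ) : Matrix (Fin 144) (Fin 144) ℝ := ∑ j : Fin 3, (ε ^ (j : ℕ)) • (l6sGG j).map (Rat.cast : ℚ → ℝ)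

/-- The real `Q`-matrix family `Qˢ(ε) = Σ_j ε^j Qˢ_j`. -/
noncomputable def l6srealQQ (ε : ℝ) : Matrix (Fin 144) (Fin 144) ℝ := ∑ j : Fin 3, (ε ^ (j : ℕ)) • (l6sQQ j).map (Rat.cast : ℚ → ℝ)

/-! ## §2 Linearity: the real families are the scatter-sums of the real block families -/

/-- **`Γˢ(ε)` is the signed scatter-sum of the real `Γ` block families.** -/
theorem l6srealGG_eq_sum_scatterS (ε : ℝ) : ∀ I J, l6srealGG ε I J =
    ∑ b ∈ Finset.range 3, scatterS (l6szP b) l6LabP l6PosP (fun I => (l6SgnP I : ℝ)) b (realXQ (l6sblkD b) ε) I J := by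
  intro I J
  have hR : ∀ b, scatterS (l6szP b) l6LabP l6PosP (fun I => (l6SgnP I : ℝ)) b (realXQ (l6sblkD b) ε) =
      ∑ j : Fin 3, (ε ^ (j : ℕ)) • scatterS (l6szP b) l6LabP l6PosP (fun I => (l6SgnP I : ℝ)) b
        ((Matrix.of fun a c => l6sblkD b j a c).map (Rat.cast : ℚ → ℝ)) := by
    intro b
    rw [realXQ, scatterS_sum6]
    refine Finset.sum_congr rfl fun j _ => ?_
    rw [scatterS_smul6]
    rfl
  simp_rw [hR]
  simp only [l6srealGG, l6sGG, Matrix.sum_apply, Matrix.smul_apply, Matrix.map_apply, smul_eq_mul, Rat.cast_sum, cast_scatterS6,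
    Finset.mul_sum]
  rw [Finset.sum_comm]

/-- **`Qˢ(ε)` is the signed scatter-sum of the real `Q` block families.** -/
theorem l6srealQQ_eq_sum_scatterS (ε : ℝ) : ∀ I J, l6srealQQ ε I J =
    ∑ b ∈ Finset.range 3, scatterS (l6szP b) l6LabP l6PosP (fun I => (l6SgnP I : ℝ)) b (realXQ (l6sblkQ b) ε) I J := by
  intro I J
  have hR : ∀ b, scatterS (l6szP b) l6LabP l6PosP (fun I => (l6SgnP I : ℝ)) b (realXQ (l6sblkQ b) ε) =
      ∑ j : Fin 3, (ε ^ (j : ℕ)) • scatterS (l6szP b) l6LabP l6PosP (fun I => (l6SgnP I : ℝ)) b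
        ((Matrix.of fun a c => l6sblkQ b j a c).map (Rat.cast : ℚ → ℝ)) := by
    intro b
    rw [realXQ, scatterS_sum6]
    refine Finset.sum_congr rfl fun j _ => ?_
    rw [scatterS_smul6]
    rfl
  simp_rw [hR]
  simp only [l6srealQQ, l6sQQ, Matrix.sum_apply, Matrix.smul_apply, Matrix.map_apply, smul_eq_mul, Rat.cast_sum, cast_scatterS6,
    Finset.mul_sum]
  rw [Finset.sum_comm]

/-! ## §3 Positivity for `0 < ε ≤ 2⁻⁵¹` -/

/-- **LAYER 1 (two-matrix): `Γˢ(ε) ⪰ 0`** for `0 < ε ≤ 2⁻⁵¹` — the three `Γ` pair-block certificates assembled by the signed scatter-sum. -/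
theorem l6srealGG_posSemidef {ε : ℝ} (hε0 : 0 < ε) (hε1 : ε ≤ 1 / 2 ^ 51) : (l6srealGG ε).PosSemidef := by
  have hε1' : ε ≤ 1 := hε1.trans (by norm_num)
  refine posSemidef_of_eq_sum_scatterS 3 l6szP l6LabP l6PosP (fun _ I => (l6SgnP I : ℝ)) (fun b => realXQ (l6sblkD b) ε)
    (fun b hb => ?_) (l6srealGG_eq_sum_scatterS ε)
  interval_cases b
  · refine l6sDuu_psd hε0 hε1' ?_
    have h : (1 : ℝ) / 2 ^ 51 * ((l6sDuurho1 + l6sDuurho2 : ℚ) : ℝ) ≤ (l6sDuumu : ℝ) := by norm_num [l6sDuurho1, l6sDuurho2, l6sDuumu]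
    have h0 : (0 : ℝ) ≤ ((l6sDuurho1 + l6sDuurho2 : ℚ) : ℝ) := by norm_num [l6sDuurho1, l6sDuurho2]
    nlinarith
  · refine l6sDmixed_psd hε0 hε1' ?_
    have h : (1 : ℝ) / 2 ^ 51 * ((l6sDmixedrho1 + l6sDmixedrho2 : ℚ) : ℝ) ≤ (l6sDmixedmu : ℝ) := by
      norm_num [l6sDmixedrho1, l6sDmixedrho2, l6sDmixedmu]
    have h0 : (0 : ℝ) ≤ ((l6sDmixedrho1 + l6sDmixedrho2 : ℚ) : ℝ) := by norm_num [l6sDmixedrho1, l6sDmixedrho2]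
    nlinarith
  · refine l6sDdd_psd hε0 hε1' ?_
    have h : (1 : ℝ) / 2 ^ 51 * ((l6sDddrho1 + l6sDddrho2 : ℚ) : ℝ) ≤ (l6sDddmu : ℝ) := by norm_num [l6sDddrho1, l6sDddrho2, l6sDddmu]
    have h0 : (0 : ℝ) ≤ ((l6sDddrho1 + l6sDddrho2 : ℚ) : ℝ) := by norm_num [l6sDddrho1, l6sDddrho2]
    nlinarith

/-- **LAYER 1 (`Q`-matrix): `Qˢ(ε) ⪰ 0`** for `0 < ε ≤ 2⁻⁵¹`. -/
theorem l6srealQQ_posSemidef {ε : ℝ} (hε0 : 0 < ε) (hε1 : ε ≤ 1 / 2 ^ 51) : (l6srealQQ ε).PosSemidef := by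
  have hε1' : ε ≤ 1 := hε1.trans (by norm_num)
  refine posSemidef_of_eq_sum_scatterS 3 l6szP l6LabP l6PosP (fun _ I => (l6SgnP I : ℝ)) (fun b => realXQ (l6sblkQ b) ε)
    (fun b hb => ?_) (l6srealQQ_eq_sum_scatterS ε)
  interval_cases b
  · refine l6sQuu_psd hε0 hε1' ?_
    have h : (1 : ℝ) / 2 ^ 51 * ((l6sQuurho1 + l6sQuurho2 : ℚ) : ℝ) ≤ (l6sQuumu : ℝ) := by norm_num [l6sQuurho1, l6sQuurho2, l6sQuumu]
    have h0 : (0 : ℝ) ≤ ((l6sQuurho1 + l6sQuurho2 : ℚ) : ℝ) := by norm_num [l6sQuurho1, l6sQuurho2]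
    nlinarith
  · refine l6sQmixed_psd hε0 hε1' ?_
    have h : (1 : ℝ) / 2 ^ 51 * ((l6sQmixedrho1 + l6sQmixedrho2 : ℚ) : ℝ) ≤ (l6sQmixedmu : ℝ) := by
      norm_num [l6sQmixedrho1, l6sQmixedrho2, l6sQmixedmu]
    have h0 : (0 : ℝ) ≤ ((l6sQmixedrho1 + l6sQmixedrho2 : ℚ) : ℝ) := by norm_num [l6sQmixedrho1, l6sQmixedrho2]
    nlinarith
  · refine l6sQdd_psd hε0 hε1' ?_
    have h : (1 : ℝ) / 2 ^ 51 * ((l6sQddrho1 + l6sQddrho2 : ℚ) : ℝ) ≤ (l6sQddmu : ℝ) := by norm_num [l6sQddrho1, l6sQddrho2, l6sQddmu]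
    have h0 : (0 : ℝ) ≤ ((l6sQddrho1 + l6sQddrho2 : ℚ) : ℝ) := by norm_num [l6sQddrho1, l6sQddrho2]
    nlinarith

end LiftL6

end Summit.Ventures.CertifiedQuantumChemistry
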